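import Summits.QuantumFields.YangMills.Theorems.SwapVirialDeficitZeroModeGroupThreeSmallBallCone
import Literature.MathematicalPhysics.QuantumLattice.SU2HaarChart
import HarnessLib

/-!
# Exact zero-mode rung Z4 in SMALL-BALL form, three letters — III: the limit event `G₀(a)`, pointwise convergence off the boundary,
# and the boundary is Lebesgue-null
# (LEAD ym-line-sfw-p2 g93 07:46Z «EXACT small-ball asymptotics `Haar³{N₃(t)} = v₃t⁴(1+O(t^θ))`»; free-hands support of ⟨stmt-QuantumFields-24197⟩)

After part II, `Haar³(N₃(t))/t⁴ = coneConst²·∫dcone(a)∫∫𝟙_{G_{t²}(axisPoint a)}` with the `t`-regular event `G_s(a) = rescaledSet s a`.  Here: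
* §5 ★ `indicator_rescaledSet_eventuallyEq` / ★ `tendsto_indicator_rescaledSet` — at every `(x, y)` off the BOUNDARY SET `Z(a)` (one of the five
  defining inequalities of `G₀(a)` is an equality) the indicator `𝟙_{G_s(a)}(x, y)` is eventually CONSTANT `= 𝟙_{G₀(a)}(x, y)` as `s → 0⁺`
  (each constraint is `g(s) ≤ h(s)` or `g(s) < h(s)` with `g, h` affine in `s`; strict inequalities persist, ✓`Filter.Tendsto.eventually_lt`);
* §6 ★ `volume_re_sq_eq_null` — for measurable `g`, `vol{x ∈ ℍ | x₀² = g(x_I, x_J, x_K)} = 0` (Fubini over `ℍ ≃ ℝ × ℝ³`, ✓`quatReImEquiv`: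
  every `x₀`-section is `⊆ {±√c}`); hence ★★ `volume_prod_boundary_null` — `(vol ⊗ vol)(Z(a)) = 0` for every hub with `‖a‖ ≠ 0` (each of the five
  pieces is a quadratic equation in `x₀` or `y₀` with non-vanishing leading coefficient off a null set).
Part IV: domination by `e³·`(w2 g55's dominator) and dominated convergence ⇒ `Haar³(N₃(t))/t⁴ → v₃′ > 0`.
HONEST LABEL: finite-dimensional measure theory (plan-level zero-mode rung of a DRAFT line); NOT the fixed-`L` sharp law of `F^S`, NOT ⟨24197⟩; the
Yang–Mills mass gap is NOT proved; no summit is proved by a line.  Seat ym-line-fcl-p3 g44 (cell ym-idea-1, free hands), `--supports stmt-QuantumFields-24197`.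
THEOREMS ONLY (0 `def`, 0 `sorry`), standard axioms; the three local instances of the ToronLog files.
References: [cite: GonzalezarroyoAltes1988]; [cite: Vanbaal2001]; [folklore].
-/

set_option autoImplicit false

noncomputable section

open MeasureTheory Quaternion Set Filter Topology
open scoped Quaternion ENNReal BigOperators Topology
open Literature.MathematicalPhysics.QuantumLattice
open Summit.QuantumFields.YangMills.Theorems.SwapTwistDeficit.ToronLog

attribute [local instance] Literature.Analysis.FluidPDE.Tao2016.quatMeasurableSpace
  Literature.Analysis.FluidPDE.Tao2016.quatBorelSpace
  Literature.MathematicalPhysics.QuantumLattice.secondCountableTopology_su2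

namespace Summit.QuantumFields.YangMills.Theorems.SwapVirialDeficit.ZeroModeGroup

/-! ## §5 Pointwise convergence of the rescaled indicators off the boundary -/

/-- `s ↦ dilNormSq s x` is continuous (affine). [folklore] -/
theorem continuous_dilNormSq_param (x : ℍ) : Continuous fun s : ℝ => dilNormSq s x := by
  unfold dilNormSq; fun_prop

/-- Persistence of a STRICT inequality between continuous functions of the parameter: if `g 0 < h 0` then `g s < h s` near `s = 0⁺`. [folklore] -/
theorem eventually_lt_of_lt_at_zero {g h : ℝ → ℝ} (hg : Continuous g) (hh : Continuous h) (h0 : g 0 < h 0) :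
    ∀ᶠ s in 𝓝[>] (0 : ℝ), g s < h s := by
  have hg0 : Tendsto g (𝓝[>] (0 : ℝ)) (𝓝 (g 0)) := (hg.tendsto 0).mono_left nhdsWithin_le_nhds
  have hh0 : Tendsto h (𝓝[>] (0 : ℝ)) (𝓝 (h 0)) := (hh.tendsto 0).mono_left nhdsWithin_le_nhds
  exact hg0.eventually_lt hh0 h0

/-- A constraint `g s ≤ h s` with `g 0 ≠ h 0` is eventually decided by its value at `s = 0`. [folklore] -/
theorem eventually_le_iff_of_ne {g h : ℝ → ℝ} (hg : Continuous g) (hh : Continuous h) (h0 : g 0 ≠ h 0) :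
    ∀ᶠ s in 𝓝[>] (0 : ℝ), (g s ≤ h s ↔ g 0 ≤ h 0) := by
  rcases lt_or_gt_of_ne h0 with hlt | hgt
  · filter_upwards [eventually_lt_of_lt_at_zero hg hh hlt] with s hs
    exact ⟨fun _ => hlt.le, fun _ => hs.le⟩
  · filter_upwards [eventually_lt_of_lt_at_zero hh hg hgt] with s hs
    exact ⟨fun h1 => absurd (lt_of_le_of_lt h1 hs) (lt_irrefl _), fun h1 => absurd (lt_of_le_of_lt h1 hgt) (lt_irrefl _)⟩

/-- A constraint `g s < h s` with `g 0 ≠ h 0` is eventually decided by its value at `s = 0`. [folklore] -/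
theorem eventually_lt_iff_of_ne {g h : ℝ → ℝ} (hg : Continuous g) (hh : Continuous h) (h0 : g 0 ≠ h 0) :
    ∀ᶠ s in 𝓝[>] (0 : ℝ), (g s < h s ↔ g 0 < h 0) := by
  rcases lt_or_gt_of_ne h0 with hlt | hgt
  · filter_upwards [eventually_lt_of_lt_at_zero hg hh hlt] with s hs
    exact ⟨fun _ => hlt, fun _ => hs⟩
  · filter_upwards [eventually_lt_of_lt_at_zero hh hg hgt] with s hs
    exact ⟨fun h1 => absurd (h1.trans hs) (lt_irrefl _), fun h1 => absurd (h1.trans hgt) (lt_irrefl _)⟩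

/-- ★ **Eventual constancy of the rescaled indicator off the boundary.**  If at `(x, y)` none of the five defining inequalities of `G₀(a)` is an
equality, then `(x, y) ∈ G_s(a) ↔ (x, y) ∈ G₀(a)` for all small `s > 0`. [folklore] -/
theorem mem_rescaledSet_eventually_iff (a x y : ℍ)
    (h1 : dilNormSq 0 x ≠ 1) (h2 : dilNormSq 0 y ≠ 1)
    (h3 : 4 * (a.imI ^ 2 * (x.imJ ^ 2 + x.imK ^ 2)) ≠ dilNormSq 0 x * ‖a‖ ^ 2)
    (h4 : 4 * (a.imI ^ 2 * (y.imJ ^ 2 + y.imK ^ 2)) ≠ dilNormSq 0 y * ‖a‖ ^ 2)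
    (h5 : 4 * ((x.imK * y.imI - x.imI * y.imK) ^ 2 + (x.imI * y.imJ - x.imJ * y.imI) ^ 2) ≠ dilNormSq 0 x * dilNormSq 0 y) :
    ∀ᶠ s in 𝓝[>] (0 : ℝ), ((x, y) ∈ rescaledSet s a ↔ (x, y) ∈ rescaledSet 0 a) := by
  have cx := continuous_dilNormSq_param x
  have cy := continuous_dilNormSq_param y
  have e1 := eventually_lt_iff_of_ne (g := fun s => dilNormSq s x) (h := fun _ => (1 : ℝ)) cx continuous_const h1
  have e2 := eventually_lt_iff_of_ne (g := fun s => dilNormSq s y) (h := fun _ => (1 : ℝ)) cy continuous_const h2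
  have c3 : Continuous fun s : ℝ => dilNormSq s x * ‖a‖ ^ 2 := cx.mul continuous_const
  have c4 : Continuous fun s : ℝ => dilNormSq s y * ‖a‖ ^ 2 := cy.mul continuous_const
  have e3 := eventually_le_iff_of_ne (g := fun _ => 4 * (a.imI ^ 2 * (x.imJ ^ 2 + x.imK ^ 2))) (h := fun s => dilNormSq s x * ‖a‖ ^ 2)
    continuous_const c3 h3
  have e4 := eventually_le_iff_of_ne (g := fun _ => 4 * (a.imI ^ 2 * (y.imJ ^ 2 + y.imK ^ 2))) (h := fun s => dilNormSq s y * ‖a‖ ^ 2)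
    continuous_const c4 h4
  have c5 : Continuous fun s : ℝ => 4 * ((x.imK * y.imI - x.imI * y.imK) ^ 2 + (x.imI * y.imJ - x.imJ * y.imI) ^ 2 +
      s * (x.imJ * y.imK - x.imK * y.imJ) ^ 2) := by fun_prop
  have c6 : Continuous fun s : ℝ => dilNormSq s x * dilNormSq s y := cx.mul cy
  have h5' : (fun s : ℝ => 4 * ((x.imK * y.imI - x.imI * y.imK) ^ 2 + (x.imI * y.imJ - x.imJ * y.imI) ^ 2 +
      s * (x.imJ * y.imK - x.imK * y.imJ) ^ 2)) 0 ≠ (fun s : ℝ => dilNormSq s x * dilNormSq s y) 0 := by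
    simp only [zero_mul, add_zero]; exact h5
  have e5 := eventually_le_iff_of_ne c5 c6 h5'
  filter_upwards [e1, e2, e3, e4, e5] with s s1 s2 s3 s4 s5
  simp only [rescaledSet, Set.mem_setOf_eq, zero_mul, add_zero] at s1 s2 s3 s4 s5 ⊢
  rw [s1, s2, s3, s4, s5]

/-- ★ **Pointwise limit of the indicators** off the boundary: `𝟙_{G_s(a)}(x,y) → 𝟙_{G₀(a)}(x,y)` as `s → 0⁺`. [folklore] -/
theorem tendsto_indicator_rescaledSet (a x y : ℍ)
    (h1 : dilNormSq 0 x ≠ 1) (h2 : dilNormSq 0 y ≠ 1)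
    (h3 : 4 * (a.imI ^ 2 * (x.imJ ^ 2 + x.imK ^ 2)) ≠ dilNormSq 0 x * ‖a‖ ^ 2)
    (h4 : 4 * (a.imI ^ 2 * (y.imJ ^ 2 + y.imK ^ 2)) ≠ dilNormSq 0 y * ‖a‖ ^ 2)
    (h5 : 4 * ((x.imK * y.imI - x.imI * y.imK) ^ 2 + (x.imI * y.imJ - x.imJ * y.imI) ^ 2) ≠ dilNormSq 0 x * dilNormSq 0 y) :
    Tendsto (fun s => (rescaledSet s a).indicator (1 : ℍ × ℍ → ℝ≥0∞) (x, y)) (𝓝[>] (0 : ℝ))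
      (𝓝 ((rescaledSet 0 a).indicator (1 : ℍ × ℍ → ℝ≥0∞) (x, y))) := by
  refine (tendsto_congr' ?_).2 tendsto_const_nhds
  filter_upwards [mem_rescaledSet_eventually_iff a x y h1 h2 h3 h4 h5] with s hs
  by_cases h : (x, y) ∈ rescaledSet 0 a
  · rw [Set.indicator_of_mem h, Set.indicator_of_mem (hs.2 h)]
  · rw [Set.indicator_of_notMem h, Set.indicator_of_notMem (fun h' => h (hs.1 h'))]

/-! ## §6 The boundary is Lebesgue-null -/

/-- A real number with prescribed square lies in a two-point set. [folklore] -/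
theorem sq_eq_subset (c : ℝ) : {r : ℝ | r ^ 2 = c} ⊆ {Real.sqrt c, -Real.sqrt c} := by
  intro r hr
  simp only [Set.mem_setOf_eq] at hr
  simp only [Set.mem_insert_iff, Set.mem_singleton_iff]
  have habs : |r| = Real.sqrt c := by rw [← hr, Real.sqrt_sq_eq_abs]
  rcases abs_choice r with h | h
  · exact Or.inl (by rw [← habs, h])
  · right; rw [← habs, h, neg_neg]

/-- `vol{r | r² = c} = 0`. [folklore] -/
theorem volume_sq_eq_null (c : ℝ) : (volume : Measure ℝ) {r : ℝ | r ^ 2 = c} = 0 :=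
  measure_mono_null (sq_eq_subset c) (((Set.finite_singleton _).insert _).measure_zero _)

/-- ★ **A quadratic equation in `x₀` cuts out a null set of `ℍ`**: for measurable `g : (Fin 3 → ℝ) → ℝ`,
`vol{x ∈ ℍ | x₀² = g(x_I, x_J, x_K)} = 0` (Fubini over `ℍ ≃ ℝ × ℝ³` ✓`quatReImEquiv`; every `x₀`-section has at most two points). [folklore] -/
theorem volume_re_sq_eq_null {g : (Fin 3 → ℝ) → ℝ} (hg : Measurable g) :
    (volume : Measure ℍ) {x : ℍ | x.re ^ 2 = g ![x.imI, x.imJ, x.imK]} = 0 := by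
  set T : Set (ℝ × (Fin 3 → ℝ)) := {p | p.1 ^ 2 = g p.2} with hT
  have hTm : MeasurableSet T := by
    rw [hT]
    exact measurableSet_eq_fun (measurable_fst.pow_const 2) (hg.comp measurable_snd)
  have hpre : {x : ℍ | x.re ^ 2 = g ![x.imI, x.imJ, x.imK]} = quatReImEquiv ⁻¹' T := by
    ext x
    simp only [Set.mem_setOf_eq, Set.mem_preimage, hT, quatReImEquiv_apply]
  rw [hpre, measurePreserving_quatReImEquiv.measure_preimage hTm.nullMeasurableSet]
  rw [show (volume : Measure (ℝ × (Fin 3 → ℝ))) = (volume : Measure ℝ).prod (volume : Measure (Fin 3 → ℝ)) from rfl,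
    Measure.prod_apply_symm hTm]
  have hsec : ∀ v : Fin 3 → ℝ, (volume : Measure ℝ) ((fun r : ℝ => (r, v)) ⁻¹' T) = 0 := by
    intro v
    have e : (fun r : ℝ => (r, v)) ⁻¹' T = {r : ℝ | r ^ 2 = g v} := by ext r; simp [hT]
    rw [e]; exact volume_sq_eq_null (g v)
  simp_rw [hsec, lintegral_zero]

/-- The same with the constraint written through a measurable function of the whole quaternion that does not depend on `x₀`:
if `G x = g(x_I,x_J,x_K)` then `vol{x | x₀² = G x} = 0`. [folklore] -/
theorem volume_re_sq_eq_null' {G : ℍ → ℝ} {g : (Fin 3 → ℝ) → ℝ} (hg : Measurable g) (hG : ∀ x, G x = g ![x.imI, x.imJ, x.imK]) :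
    (volume : Measure ℍ) {x : ℍ | x.re ^ 2 = G x} = 0 := by
  have e : {x : ℍ | x.re ^ 2 = G x} = {x : ℍ | x.re ^ 2 = g ![x.imI, x.imJ, x.imK]} := by
    ext x; simp only [Set.mem_setOf_eq, hG]
  rw [e]; exact volume_re_sq_eq_null hg

/-- Measurability of coordinate polynomials on `ℝ³`. [folklore] -/
theorem measurable_fin3 : (Measurable fun v : Fin 3 → ℝ => v 0) ∧ (Measurable fun v : Fin 3 → ℝ => v 1) ∧ (Measurable fun v : Fin 3 → ℝ => v 2) :=
  ⟨measurable_pi_apply 0, measurable_pi_apply 1, measurable_pi_apply 2⟩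

/-- (z1) The sphere piece `{x | x₀² + x_I² = 1}` is null. [folklore] -/
theorem volume_normZero_eq_one_null : (volume : Measure ℍ) {x : ℍ | dilNormSq 0 x = 1} = 0 := by
  obtain ⟨m0, -, -⟩ := measurable_fin3
  have e : {x : ℍ | dilNormSq 0 x = 1} = {x : ℍ | x.re ^ 2 = (fun x : ℍ => 1 - x.imI ^ 2) x} := by
    ext x; simp only [Set.mem_setOf_eq, dilNormSq_zero]; constructor <;> intro h <;> linarith
  rw [e]
  exact volume_re_sq_eq_null' (g := fun v => 1 - v 0 ^ 2) (measurable_const.sub (m0.pow_const 2)) fun x => by simp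

/-- (z0) The axis piece `{x | x₀² + x_I² = 0}` is null. [folklore] -/
theorem volume_normZero_eq_zero_null : (volume : Measure ℍ) {x : ℍ | dilNormSq 0 x = 0} = 0 := by
  obtain ⟨m0, -, -⟩ := measurable_fin3
  have e : {x : ℍ | dilNormSq 0 x = 0} = {x : ℍ | x.re ^ 2 = (fun x : ℍ => -x.imI ^ 2) x} := by
    ext x; simp only [Set.mem_setOf_eq, dilNormSq_zero]; constructor <;> intro h <;> linarith
  rw [e]
  exact volume_re_sq_eq_null' (g := fun v => -v 0 ^ 2) (m0.pow_const 2).neg fun x => by simp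

/-- (z3) The hub-constraint boundary `{x | 4a_I²(x_J² + x_K²) = (x₀² + x_I²)‖a‖²}` is null when `‖a‖ ≠ 0`. [folklore] -/
theorem volume_hubBoundary_null {a : ℍ} (ha : ‖a‖ ≠ 0) :
    (volume : Measure ℍ) {x : ℍ | 4 * (a.imI ^ 2 * (x.imJ ^ 2 + x.imK ^ 2)) = dilNormSq 0 x * ‖a‖ ^ 2} = 0 := by
  obtain ⟨m0, m1, m2⟩ := measurable_fin3
  have ha2 : ‖a‖ ^ 2 ≠ 0 := pow_ne_zero 2 ha
  have e : {x : ℍ | 4 * (a.imI ^ 2 * (x.imJ ^ 2 + x.imK ^ 2)) = dilNormSq 0 x * ‖a‖ ^ 2} =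
      {x : ℍ | x.re ^ 2 = (fun x : ℍ => 4 * (a.imI ^ 2 * (x.imJ ^ 2 + x.imK ^ 2)) / ‖a‖ ^ 2 - x.imI ^ 2) x} := by
    ext x; simp only [Set.mem_setOf_eq, dilNormSq_zero]
    constructor
    · intro h; field_simp; linarith
    · intro h; field_simp at h; linarith
  rw [e]
  exact volume_re_sq_eq_null' (g := fun v => 4 * (a.imI ^ 2 * (v 1 ^ 2 + v 2 ^ 2)) / ‖a‖ ^ 2 - v 0 ^ 2)
    (((((m1.pow_const 2).add (m2.pow_const 2)).const_mul _).const_mul _).div_const _ |>.sub (m0.pow_const 2)) fun x => by simp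

/-- (z5) The coupled-constraint boundary, `x`-section at a letter `y` with `y₀² + y_I² ≠ 0`:
`{x | 4[(x_Ky_I − x_Iy_K)² + (x_Iy_J − x_Jy_I)²] = (x₀² + x_I²)(y₀² + y_I²)}` is null. [folklore] -/
theorem volume_coupledBoundary_section_null {y : ℍ} (hy : dilNormSq 0 y ≠ 0) :
    (volume : Measure ℍ) {x : ℍ | 4 * ((x.imK * y.imI - x.imI * y.imK) ^ 2 + (x.imI * y.imJ - x.imJ * y.imI) ^ 2) =
      dilNormSq 0 x * dilNormSq 0 y} = 0 := by
  obtain ⟨m0, m1, m2⟩ := measurable_fin3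
  set D := dilNormSq 0 y with hD
  have e : {x : ℍ | 4 * ((x.imK * y.imI - x.imI * y.imK) ^ 2 + (x.imI * y.imJ - x.imJ * y.imI) ^ 2) = dilNormSq 0 x * D} =
      {x : ℍ | x.re ^ 2 = (fun x : ℍ => 4 * ((x.imK * y.imI - x.imI * y.imK) ^ 2 + (x.imI * y.imJ - x.imJ * y.imI) ^ 2) / D - x.imI ^ 2) x} := by
    ext x; simp only [Set.mem_setOf_eq, dilNormSq_zero]
    constructor
    · intro h; field_simp; linarith
    · intro h; field_simp at h; linarith
  rw [e]
  exact volume_re_sq_eq_null'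
    (g := fun v => 4 * ((v 2 * y.imI - v 0 * y.imK) ^ 2 + (v 0 * y.imJ - v 1 * y.imI) ^ 2) / D - v 0 ^ 2)
    ((((((m2.mul_const _).sub (m0.mul_const _)).pow_const 2).add (((m0.mul_const _).sub (m1.mul_const _)).pow_const 2)).const_mul _).div_const _
      |>.sub (m0.pow_const 2)) fun x => by simp

/-- ★★ **The boundary of `G₀(a)` is `(vol ⊗ vol)`-null** (`‖a‖ ≠ 0`): almost every `(x, y)` satisfies the five non-degeneracy conditions of
`tendsto_indicator_rescaledSet`. [folklore] -/
theorem ae_not_boundary {a : ℍ} (ha : ‖a‖ ≠ 0) :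
    ∀ᵐ p : ℍ × ℍ ∂((volume : Measure ℍ).prod (volume : Measure ℍ)),
      dilNormSq 0 p.1 ≠ 1 ∧ dilNormSq 0 p.2 ≠ 1 ∧
      4 * (a.imI ^ 2 * (p.1.imJ ^ 2 + p.1.imK ^ 2)) ≠ dilNormSq 0 p.1 * ‖a‖ ^ 2 ∧
      4 * (a.imI ^ 2 * (p.2.imJ ^ 2 + p.2.imK ^ 2)) ≠ dilNormSq 0 p.2 * ‖a‖ ^ 2 ∧
      4 * ((p.1.imK * p.2.imI - p.1.imI * p.2.imK) ^ 2 + (p.1.imI * p.2.imJ - p.1.imJ * p.2.imI) ^ 2) ≠ dilNormSq 0 p.1 * dilNormSq 0 p.2 := by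
  -- pieces depending on one letter only
  have hx1 : ∀ᵐ p : ℍ × ℍ ∂((volume : Measure ℍ).prod (volume : Measure ℍ)), dilNormSq 0 p.1 ≠ 1 := by
    have h : ∀ᵐ x : ℍ ∂(volume : Measure ℍ), dilNormSq 0 x ≠ 1 := by
      rw [ae_iff]; simpa only [ne_eq, not_not] using volume_normZero_eq_one_null
    exact (Measure.quasiMeasurePreserving_fst).ae (p := fun x : ℍ => dilNormSq 0 x ≠ 1) h
  have hy1 : ∀ᵐ p : ℍ × ℍ ∂((volume : Measure ℍ).prod (volume : Measure ℍ)), dilNormSq 0 p.2 ≠ 1 := by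
    have h : ∀ᵐ y : ℍ ∂(volume : Measure ℍ), dilNormSq 0 y ≠ 1 := by
      rw [ae_iff]; simpa only [ne_eq, not_not] using volume_normZero_eq_one_null
    exact (Measure.quasiMeasurePreserving_snd).ae (p := fun y : ℍ => dilNormSq 0 y ≠ 1) h
  have hx3 : ∀ᵐ p : ℍ × ℍ ∂((volume : Measure ℍ).prod (volume : Measure ℍ)),
      4 * (a.imI ^ 2 * (p.1.imJ ^ 2 + p.1.imK ^ 2)) ≠ dilNormSq 0 p.1 * ‖a‖ ^ 2 := by
    have h : ∀ᵐ x : ℍ ∂(volume : Measure ℍ), 4 * (a.imI ^ 2 * (x.imJ ^ 2 + x.imK ^ 2)) ≠ dilNormSq 0 x * ‖a‖ ^ 2 := by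
      rw [ae_iff]; simpa only [ne_eq, not_not] using volume_hubBoundary_null ha
    exact (Measure.quasiMeasurePreserving_fst).ae (p := fun x : ℍ => 4 * (a.imI ^ 2 * (x.imJ ^ 2 + x.imK ^ 2)) ≠ dilNormSq 0 x * ‖a‖ ^ 2) h
  have hy3 : ∀ᵐ p : ℍ × ℍ ∂((volume : Measure ℍ).prod (volume : Measure ℍ)),
      4 * (a.imI ^ 2 * (p.2.imJ ^ 2 + p.2.imK ^ 2)) ≠ dilNormSq 0 p.2 * ‖a‖ ^ 2 := by
    have h : ∀ᵐ y : ℍ ∂(volume : Measure ℍ), 4 * (a.imI ^ 2 * (y.imJ ^ 2 + y.imK ^ 2)) ≠ dilNormSq 0 y * ‖a‖ ^ 2 := by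
      rw [ae_iff]; simpa only [ne_eq, not_not] using volume_hubBoundary_null ha
    exact (Measure.quasiMeasurePreserving_snd).ae (p := fun y : ℍ => 4 * (a.imI ^ 2 * (y.imJ ^ 2 + y.imK ^ 2)) ≠ dilNormSq 0 y * ‖a‖ ^ 2) h
  -- the coupled piece: Fubini with the `y`-letter outside
  have h5 : ∀ᵐ p : ℍ × ℍ ∂((volume : Measure ℍ).prod (volume : Measure ℍ)),
      4 * ((p.1.imK * p.2.imI - p.1.imI * p.2.imK) ^ 2 + (p.1.imI * p.2.imJ - p.1.imJ * p.2.imI) ^ 2) ≠ dilNormSq 0 p.1 * dilNormSq 0 p.2 := by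
    obtain ⟨hI1, hJ1, hK1⟩ := measurable_coords_fst
    obtain ⟨hI2, hJ2, hK2⟩ := measurable_coords_snd
    have hN1 : Measurable fun p : ℍ × ℍ => dilNormSq 0 p.1 := (continuous_dilNormSq 0).measurable.comp measurable_fst
    have hN2 : Measurable fun p : ℍ × ℍ => dilNormSq 0 p.2 := (continuous_dilNormSq 0).measurable.comp measurable_snd
    have hSm : MeasurableSet {p : ℍ × ℍ |
        4 * ((p.1.imK * p.2.imI - p.1.imI * p.2.imK) ^ 2 + (p.1.imI * p.2.imJ - p.1.imJ * p.2.imI) ^ 2) = dilNormSq 0 p.1 * dilNormSq 0 p.2} :=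
      measurableSet_eq_fun (((((hK1.mul hI2).sub (hI1.mul hK2)).pow_const 2).add (((hI1.mul hJ2).sub (hJ1.mul hI2)).pow_const 2)).const_mul _)
        (hN1.mul hN2)
    rw [ae_iff]
    have e : {p : ℍ × ℍ | ¬(4 * ((p.1.imK * p.2.imI - p.1.imI * p.2.imK) ^ 2 + (p.1.imI * p.2.imJ - p.1.imJ * p.2.imI) ^ 2) ≠
        dilNormSq 0 p.1 * dilNormSq 0 p.2)} = {p : ℍ × ℍ |
        4 * ((p.1.imK * p.2.imI - p.1.imI * p.2.imK) ^ 2 + (p.1.imI * p.2.imJ - p.1.imJ * p.2.imI) ^ 2) = dilNormSq 0 p.1 * dilNormSq 0 p.2} := by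
      ext p; simp only [ne_eq, not_not, Set.mem_setOf_eq]
    rw [e, Measure.prod_apply_symm hSm]
    have hsec : ∀ᵐ y : ℍ ∂(volume : Measure ℍ), (volume : Measure ℍ) ((fun x : ℍ => (x, y)) ⁻¹' {p : ℍ × ℍ |
        4 * ((p.1.imK * p.2.imI - p.1.imI * p.2.imK) ^ 2 + (p.1.imI * p.2.imJ - p.1.imJ * p.2.imI) ^ 2) = dilNormSq 0 p.1 * dilNormSq 0 p.2}) = 0 := by
      have hy0 : ∀ᵐ y : ℍ ∂(volume : Measure ℍ), dilNormSq 0 y ≠ 0 := by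
        rw [ae_iff]; simpa only [ne_eq, not_not] using volume_normZero_eq_zero_null
      filter_upwards [hy0] with y hy
      exact volume_coupledBoundary_section_null hy
    rw [lintegral_congr_ae hsec, lintegral_zero]
  filter_upwards [hx1, hy1, hx3, hy3, h5] with p p1 p2 p3 p4 p5
  exact ⟨p1, p2, p3, p4, p5⟩

/-- ★★ **Almost-everywhere pointwise limit**: for a hub with `‖a‖ ≠ 0`, for `(vol ⊗ vol)`-a.e. `(x, y)`,
`𝟙_{G_s(a)}(x, y) → 𝟙_{G₀(a)}(x, y)` as `s → 0⁺`. [folklore] -/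
theorem ae_tendsto_indicator_rescaledSet {a : ℍ} (ha : ‖a‖ ≠ 0) :
    ∀ᵐ p : ℍ × ℍ ∂((volume : Measure ℍ).prod (volume : Measure ℍ)),
      Tendsto (fun s => (rescaledSet s a).indicator (1 : ℍ × ℍ → ℝ≥0∞) p) (𝓝[>] (0 : ℝ))
        (𝓝 ((rescaledSet 0 a).indicator (1 : ℍ × ℍ → ℝ≥0∞) p)) := by
  filter_upwards [ae_not_boundary ha] with p hp
  exact tendsto_indicator_rescaledSet a p.1 p.2 hp.1 hp.2.1 hp.2.2.1 hp.2.2.2.1 hp.2.2.2.2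

end Summit.QuantumFields.YangMills.Theorems.SwapVirialDeficit.ZeroModeGroup

end
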